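import Summits.PneNP.PneNP.Theorems.ConvexRankGatesConvexGateBlindExactLiftingTriangleJumpGen
import Summits.PneNP.PneNP.Theorems.ConvexRankGatesConvexGateBlindExactLiftingTriangleMonoSet

/-!
# Triangle instance — strict factorisations of `M_t − εJ` never have their generators in `cone{1_L}`

Support file for crux `ConvexGateBlind` (stmt-PneNP-10680), open stub `stub_exactLifting`; prover seat 0, session 36,
memo ANALYSIS15 §3. A structural remark that locates ALL the ε-sensitivity of the triangle matrix outside the regrouping class:
for `ε > 0` (and `t ≥ 2`) there is NO factorisation `M_t − εJ = Σ_i u_i ⊗ g_i` with `u ≥ 0` and every `g_i` a non-negative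
combination of line indicators — with ANY number of terms (`no_strict_regrouping`). Indeed a nondegenerate row would give
`M_x − ε·1 ∈ cone{1_L}`; since the `t²` lines of one direction sum to `1`, adding `ε` to their coefficients yields a
representation of `M_x` with coefficients `≥ 0`, hence (uniqueness of the line representation of a nondegenerate row,
`lineRep_unique`) equal to `[L mono_x]` — impossible on a bichromatic line of that direction, where it would be `−ε + (≥ 0)`.
So every strict factorisation uses generators outside `cone{1_L}` (points, mono-sets, …); regrouping rigidity
(`…TriangleRegroupingRigidity`) describes the `ε = 0` family inside the cone class, and R1* is exactly the statement that the
`3t²`-term `ε = 0` family lies inside it. Registered sub-goal `triangle_no_strict_regrouping` (self-contained signature).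
-/

set_option linter.dupNamespace false -- `Summit.PneNP.PneNP.…`: summit = sub-problem (D-0017)

namespace Summit.PneNP.PneNP.Theorems.XorDoor.TriLine

open Finset

noncomputable section

variable {t : ℕ} {ι : Type} [Fintype ι]

/-- **A shifted nondegenerate row is not in the cone of lines**: `M_x − ε·1 = Σ_L c_L 1_L` with `c ≥ 0` forces `ε ≤ 0`. -/
theorem shift_le_zero_of_cone {x : Col t} (hx : mu x ≠ 0) {ε : ℝ} {c : Line t → ℝ} (hc : ∀ L, 0 ≤ c L)
    (hrep : ∀ w, ∑ L, c L * lind L w = (monoCount x w : ℝ) - ε) : ε ≤ 0 := by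
  classical
  -- add `ε` on the lines of the first direction: a non-negative representation of `M_x` itself
  set c' : Line t → ℝ := fun L => c L + ε * Sum.elim (fun _ => 1) (fun _ => 0) L with hc'
  have hrep' : ∀ w, ∑ L, c' L * lind L w = (monoCount x w : ℝ) := by
    intro w
    have h1 : ∑ L : Line t, ε * Sum.elim (fun _ => (1 : ℝ)) (fun _ => 0) L * lind L w = ε := by
      rw [Fintype.sum_sum_type, Fintype.sum_sum_type]
      simp only [Sum.elim_inl, Sum.elim_inr, mul_one, mul_zero, zero_mul, sum_const_zero, add_zero, ← mul_sum,
        sum_lind_inl_dir w]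
    simp only [hc', add_mul, sum_add_distrib, hrep w, h1]
    ring
  -- a bichromatic line of the first direction
  obtain ⟨⟨a₁, a₂, ha⟩, ⟨b₁, b₂, hb⟩, -⟩ := (mu_ne_zero_iff_two_coloured x).1 hx
  obtain ⟨-, ⟨b₀, hb₀⟩⟩ := exists_eq_and_ne hb (x.1 a₁)
  have hbi : ¬ lmono x (Sum.inl (a₁, b₀)) := fun h => hb₀ ((lmono_inl x (a₁, b₀)).1 h).symm
  -- on that line: sign condition only needed on bichromatic lines, and `c' ≥ c ≥ 0` there? careful: `c'` may be negative
  -- if `ε < 0`; but then we are done anyway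
  by_cases hε : ε ≤ 0
  · exact hε
  · push Not at hε
    have hc'nn : ∀ L, ¬ lmono x L → 0 ≤ c' L := by
      intro L _
      simp only [hc']
      refine add_nonneg (hc L) (mul_nonneg hε.le ?_)
      rcases L with ab | ad | bd <;> simp
    have h := lineRep_unique hx hc'nn hrep' (Sum.inl (a₁, b₀))
    unfold mInd at h
    rw [if_neg hbi] at h
    simp only [hc', Sum.elim_inl, mul_one] at h
    linarith [hc (Sum.inl (a₁, b₀))]

/-- **No strict regrouping**: for `ε > 0` and `t ≥ 2`, `M_t − εJ` has no factorisation `Σ_i u_i ⊗ (Σ_L α_{iL} 1_L)` with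
`u, α ≥ 0`, whatever the number of terms. -/
theorem no_strict_regrouping (ht : 2 ≤ t) {ε : ℝ} (hε : 0 < ε) {u : ι → Col t → ℝ} (hu : ∀ i x, 0 ≤ u i x)
    {α : ι → Line t → ℝ} (hα : ∀ i L, 0 ≤ α i L) :
    ¬ ∀ x w, ∑ i, u i x * ∑ L, α i L * lind L w = (monoCount x w : ℝ) - ε := by
  intro hfact
  -- a nondegenerate row
  have p₀ : Fin t := ⟨0, by omega⟩
  set x := goodRow p₀ (Sum.inl (p₀, p₀)) with hxdef
  have hx : mu x ≠ 0 := mu_goodRow_ne_zero ht p₀ _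
  have hrep : ∀ w, ∑ L, (∑ i, u i x * α i L) * lind L w = (monoCount x w : ℝ) - ε := by
    intro w
    rw [← hfact x w]
    simp only [sum_mul, mul_sum]
    rw [sum_comm]
    exact sum_congr rfl fun i _ => sum_congr rfl fun L _ => by ring
  have h := shift_le_zero_of_cone hx (fun L => sum_nonneg fun i _ => mul_nonneg (hu i x) (hα i L)) hrep
  linarith

/-- **Strict factorisations of the triangle matrix never live in the regrouping class** (registered sub-goal
`triangle_no_strict_regrouping` of stmt-PneNP-10680, verbatim signature, self-contained vocabulary): for `t ≥ 2`, `ε > 0`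
and any number `R` of terms there are no `u ≥ 0`, `α ≥ 0` with `Σ_i u_i(x) Σ_L α_{iL} 1_L(w) = M_t[x,w] − ε` for all rows
`x` (three `2`-colourings of `Fin t`) and transversal triangles `w` (lines `(Fin t × Fin t) ⊕ (Fin t × Fin t) ⊕
(Fin t × Fin t)`, membership written out with `Sum.elim`). -/
theorem triangle_no_strict_regrouping : ∀ (t R : ℕ) (ε : ℝ), 2 ≤ t → 0 < ε → ∀ (u : Fin R → (Fin t → Bool) × (Fin t
    → Bool) × (Fin t → Bool) → ℝ) (α : Fin R → (Fin t × Fin t) ⊕ (Fin t × Fin t) ⊕ (Fin t × Fin t) → ℝ), (∀ i x, 0 ≤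
    u i x) → (∀ i L, 0 ≤ α i L) → ¬ ∀ (x : (Fin t → Bool) × (Fin t → Bool) × (Fin t → Bool)) (w : Fin t × Fin t × Fin
    t), ∑ i, u i x * ∑ L, α i L * Sum.elim (fun ab : Fin t × Fin t => if w.1 = ab.1 ∧ w.2.1 = ab.2 then (1 : ℝ) else
    0) (Sum.elim (fun ad : Fin t × Fin t => if w.1 = ad.1 ∧ w.2.2 = ad.2 then (1 : ℝ) else 0) (fun bd : Fin t × Fin t
    => if w.2.1 = bd.1 ∧ w.2.2 = bd.2 then (1 : ℝ) else 0)) L = ((if x.1 w.1 = x.2.1 w.2.1 then 1 else 0) + (if x.1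
    w.1 = x.2.2 w.2.2 then 1 else 0) + (if x.2.1 w.2.1 = x.2.2 w.2.2 then 1 else 0) : ℝ) - ε := by
  intro t R ε ht hε u α hu hα hfact
  refine no_strict_regrouping ht hε hu hα fun x w => ?_
  rw [← sum_congr rfl fun i _ => by rw [← sum_congr rfl fun L _ => by rw [lind_eq_elim L w]], hfact x w]
  simp only [monoCount]; push_cast; ring

end

end Summit.PneNP.PneNP.Theorems.XorDoor.TriLine
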